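import Mathlib.Analysis.InnerProductSpace.PiL2
import Mathlib.Data.ZMod.Basic
import Mathlib.Algebra.Order.Floor.Ring
import Mathlib.Tactic.Module
import Literature.MathematicalPhysics.StatisticalMechanics.Theil2006
import Literature.MathematicalPhysics.StatisticalMechanics.Theil2006Decay
import HarnessLib

/-!
# Theil 2006, Lemma 2.2 (minimum distance in ground states) — proof

Topic `Literature/MathematicalPhysics/StatisticalMechanics`. DISCHARGE of the named fact
`Literature.MathematicalPhysics.StatisticalMechanics.Theil2006_minimumDistance` of `Theil2006.lean`:
`Theil2006_minimumDistance_holds : Theil2006_minimumDistance`, sorry-free, so that users of the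
fact (e.g. `Theil2006_shortRangeBonds.of_isMinimizer`) feed `Theil2006_minimumDistance_holds` for
`(h : Theil2006_minimumDistance)`. No new definitions and no named facts: theorems only.

## Source and what is proved

F. Theil, *A proof of crystallization in two dimensions*, Comm. Math. Phys. **262** (2006)
209–236, §2.2 (read in the author's preprint of 26 Aug 2005, same numbering).

**Lemma 2.2 (Minimum distance).** "There exists a number `α₀ ∈ (0, 1/3)` such that for each
`α ∈ (0, α₀)` and each `V` satisfying (1)–(5) all ground states `y_N : X_N → ℝ²` of `E(·)` satisfy
the estimate (13) `min_{x ≠ x'} |y(x) - y(x')| > 1 - α`." We prove it, for the real-valued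
(soft-core) potentials of `Theil2006.IsAdmissible`, with the explicit threshold
`α₀ = 1/13447168` (Theil does not optimise constants either).

The printed proof: let `M := max_η #(y(X) ∩ B(η, ½(1-α)))`; it suffices to show `M = 1`. With the
maximum attained at `η = 0`, `B_M = B(0, ½(1-α))`, `𝒜 = y⁻¹(B_M)`: by (2)
`∑_{p ⊂ 𝒜} e(p) ≥ M(M-1)/(2α)`; "as we could move the positions `y(𝒜)` to infinity in such a
way that the mutual distances diverge", (14) `∑_{x ∈ 𝒜, x' ∉ 𝒜} e({x,x'}) ≤ -M(M-1)/(2α)`; with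
`n(k) := #y⁻¹((k+1)B_M ∖ k B_M) ≤ C M k` (covering the ring by `C k` translates of `B_M`), the
decay (12) for `k ≥ 9` (15) and the uniform bound (11) `V ≥ -2` for the inner rings (16) give
(17) `-C M² (∑_{k=2}^{8} 2k + α ∑_{k ≥ 9} ((1-α)(k-1)/2)⁻⁵) ≤ -M(M-1)/(2α)`, impossible for small
`α` unless `M = 1`.

## Proof architecture (deviations from the printed argument are bookkeeping only)

* `IsAdmissible.le_apply_of_mem_Ioo`, `IsAdmissible.lowerBound` — **Lemma 2.1 (11)** in the form
  `V ≥ -134` on `[0, ∞)` for `0 < α ≤ 1/5` (Theil: `V ≥ -2`, "directly from (3), (5) and the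
  definition of `V_*`"; the constant is immaterial). Near the well, `r ∈ (1-α, 1+α)`, it comes
  from the normalization (1), `-6 ≤ ∑_{ξ ∈ A₂∖0} V(r|ξ|)`: the six nearest neighbours contribute
  `6 V(r)`, every other `ξ` has `r|ξ| ≥ (4/5)√3 > 4/3` and contributes `≤ (1/30)(r|ξ|)⁻⁵` by the
  decay (12) (`IsAdmissible.abs_apply_le` of `Theil2006Decay.lean`), and these tails have
  uniformly bounded partial sums; elsewhere (11) is (2), (4) or (12). On the way (private
  helpers): the norm form `m² + mn + n²` of `A₂` is `≠ 2`, equals `1` exactly at the six nearest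
  neighbours (Remark 2.5), and is `≥ 3` otherwise (cf. `Theil2006EnergyBounds.lean`, which has
  the shells and an `∃ C` form of (11); Lemma 2.2 below consumes the explicit constant).
* Summable weights replace the ring count `n(k) ≤ C M k`: the plane is cut into the half-open
  squares of side `ρ = ½(1-α)` cornered at `η₀ + ρℤ²`; each square lies in a closed disc of
  radius `ρ`, hence holds `≤ M` particles (`sum_cellWeight_le`), and a particle in the square
  labelled `(a, b)` interacts with each particle of `𝒜` with energy `≥ -K₀ w(a) w(b)`,
  `w(n) = ((|n|+1)(|n|+2))⁻¹`, `K₀ = 420224` (`IsAdmissible.neg_cellWeight_le`: (11) for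
  `max(|a|,|b|) ≤ 6`, (12) beyond, where the distance is `≥ ρ(max(|a|,|b|) - 2) ≥ 2`); the
  product weights have all finite partial sums `≤ 4` (`sum_prod_inv_natAbs_le_four`,
  telescoping), so the bonds between `𝒜` and the rest total `≥ -M² W`, `W = 4 K₀`.
* `IsMinimizer.sum_ite_mem_le_zero` — (14): for a minimiser and any label set `𝒜`, the bonds
  meeting `𝒜` have total energy `≤ 0`; the competitor puts the particles of `𝒜` at `D(k+2) b₁`,
  `D = ∑_k |y(k)| + R + 1`, mutually and from the rest at distance `≥ R`, where `V < ε` on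
  `[R, ∞)` (`V → 0`), and `ε → 0`.
* `sum_Ioi_ite_mem_and_mem`, `sum_Ioi_cross_le` — the double sums over `i < j`:
  `#{i<j in 𝒜} = M(M-1)/2` and the cross terms are `≤ M ∑_j w_j`.
* `Theil2006_minimumDistance_holds` — a pair at distance `≤ 1-α` gives `M ≥ 2` (disc about the
  midpoint); `M` is attained (`Nat.sSup_mem`); (2) prices the `M(M-1)/2` inner bonds at `≥ 1/α`
  each (distance `≤ 2ρ = 1-α`); hence `M(M-1)/(2α) ≤ M² W`, i.e. `α ≥ 1/(8W) = α₀` — contradiction.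
-/

noncomputable section

open scoped BigOperators Topology
open Filter Set Metric

namespace Literature.MathematicalPhysics.StatisticalMechanics

namespace Theil2006


/-! ### The norm form of `A₂` at and off the nearest neighbours -/

section NormForm

/-- The norm form `m² + mn + n²` of `A₂` never takes the value `2` (reduce modulo `4`).
(Private helper; cf. `Theil2006.three_le_normForm` of `Theil2006EnergyBounds.lean`.) [folklore] -/
private theorem normForm_ne_two (k : ℤ × ℤ) : k.1 ^ 2 + k.1 * k.2 + k.2 ^ 2 ≠ 2 := by
  intro h
  have key : ∀ a b : ZMod 4, a ^ 2 + a * b + b ^ 2 ≠ 2 := by decide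
  have h' := congrArg (Int.cast : ℤ → ZMod 4) h
  push_cast at h'
  exact key _ _ h'

/-- The norm form equals `1` exactly at the labels of the six nearest neighbours
`±b₁, ±b₂, ±(b₁ - b₂)` of the origin (Theil 2006, Remark 2.5: every point of `A₂` has exactly six
points of `A₂` at distance in `(0, 1]`). (Private helper.) [cite: Theil2006, §2.3 Remark 2.5] -/
private theorem normForm_eq_one_iff (k : ℤ × ℤ) : k.1 ^ 2 + k.1 * k.2 + k.2 ^ 2 = 1 ↔
    k ∈ ({(1, 0), (0, 1), (-1, 0), (0, -1), (1, -1), (-1, 1)} : Finset (ℤ × ℤ)) := by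
  obtain ⟨a, b⟩ := k
  simp only [Finset.mem_insert, Finset.mem_singleton, Prod.mk.injEq]
  constructor
  · intro h
    have ha4 : 3 * a ^ 2 ≤ 4 := by nlinarith [sq_nonneg (a + 2 * b)]
    have hb4 : 3 * b ^ 2 ≤ 4 := by nlinarith [sq_nonneg (2 * a + b)]
    have ha : a ^ 2 ≤ 1 := by omega
    have hb : b ^ 2 ≤ 1 := by omega
    obtain ⟨ha1, ha2⟩ := abs_le.1 ((sq_le_one_iff_abs_le_one a).1 ha)
    obtain ⟨hb1, hb2⟩ := abs_le.1 ((sq_le_one_iff_abs_le_one b).1 hb)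
    interval_cases a <;> interval_cases b <;> simp_all
  · rintro (⟨rfl, rfl⟩ | ⟨rfl, rfl⟩ | ⟨rfl, rfl⟩ | ⟨rfl, rfl⟩ | ⟨rfl, rfl⟩ | ⟨rfl, rfl⟩) <;>
      norm_num

/-- Off the origin and the six nearest neighbours the norm form of `A₂` is `≥ 3` (the second
shell of `A₂` has radius `√3`). (A private copy of `Theil2006.three_le_normForm` of
`Theil2006EnergyBounds.lean`, stated with the literal shell.) [folklore] -/
private theorem three_le_normForm' {k : ℤ × ℤ} (hk : k ≠ 0)
    (hk' : k ∉ ({(1, 0), (0, 1), (-1, 0), (0, -1), (1, -1), (-1, 1)} : Finset (ℤ × ℤ))) :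
    3 ≤ k.1 ^ 2 + k.1 * k.2 + k.2 ^ 2 := by
  have h1 := one_le_normForm hk
  have h2 := normForm_ne_two k
  have h3 : k.1 ^ 2 + k.1 * k.2 + k.2 ^ 2 ≠ 1 := fun h => hk' ((normForm_eq_one_iff k).1 h)
  omega

end NormForm

/-! ### Product weights on `ℤ × ℤ` with uniformly bounded partial sums

The weight `w(n) = ((|n|+1)(|n|+2))⁻¹` on `ℤ` has all finite partial sums `≤ 2` (telescoping), so
the product weight `w(a) w(b)` on `ℤ × ℤ` has all finite partial sums `≤ 4`; it dominates every
`|k|⁻⁴`-type lattice tail met below. (Written out in full; no auxiliary definition.) -/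

section Weights

/-- Telescoping: `∑_{n<K} ((n+1)(n+2))⁻¹ = 1 - (K+1)⁻¹ ≤ 1`. [folklore] -/
theorem sum_range_inv_mul_succ_le_one (K : ℕ) :
    ∑ n ∈ Finset.range K, (((n : ℝ) + 1) * ((n : ℝ) + 2))⁻¹ ≤ 1 := by
  have h : ∀ n ∈ Finset.range K, (((n : ℝ) + 1) * ((n : ℝ) + 2))⁻¹ =
      ((n : ℝ) + 1)⁻¹ - (((n + 1 : ℕ) : ℝ) + 1)⁻¹ := by
    intro n _
    push_cast
    field_simp
    ring
  rw [Finset.sum_congr rfl h, Finset.sum_range_sub' (fun n : ℕ => ((n : ℝ) + 1)⁻¹) K]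
  simp only [Nat.cast_zero, zero_add, inv_one]
  have : 0 ≤ ((K : ℝ) + 1)⁻¹ := by positivity
  linarith

/-- Every finite partial sum of `n ↦ ((n+1)(n+2))⁻¹` over `ℕ` is `≤ 1`. [folklore] -/
theorem sum_inv_mul_succ_le_one (u : Finset ℕ) :
    ∑ n ∈ u, (((n : ℝ) + 1) * ((n : ℝ) + 2))⁻¹ ≤ 1 := by
  have hsub : u ⊆ Finset.range (u.sup id + 1) := fun n hn =>
    Finset.mem_range.2 (Nat.lt_succ_of_le (Finset.le_sup (f := id) hn))
  exact (Finset.sum_le_sum_of_subset_of_nonneg hsub fun n _ _ => by positivity).trans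
    (sum_range_inv_mul_succ_le_one _)

/-- Every finite partial sum of the weight `a ↦ ((|a|+1)(|a|+2))⁻¹` over `ℤ` is `≤ 2` (each
value of `|a|` is taken at most twice). [folklore] -/
theorem sum_inv_natAbs_le_two (s : Finset ℤ) :
    ∑ a ∈ s, (((a.natAbs : ℝ) + 1) * ((a.natAbs : ℝ) + 2))⁻¹ ≤ 2 := by
  classical
  rw [Finset.sum_comp (fun n : ℕ => (((n : ℝ) + 1) * ((n : ℝ) + 2))⁻¹) Int.natAbs]
  have hfib : ∀ n : ℕ, ((s.filter fun a => a.natAbs = n).card : ℝ) ≤ 2 := by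
    intro n
    have hsub : (s.filter fun a => a.natAbs = n) ⊆ ({(n : ℤ), -(n : ℤ)} : Finset ℤ) := by
      intro a ha
      rw [Finset.mem_filter] at ha
      rw [Finset.mem_insert, Finset.mem_singleton]
      rcases Int.natAbs_eq a with h | h
      · exact Or.inl (by rw [h, ha.2])
      · exact Or.inr (by rw [h, ha.2])
    exact_mod_cast (Finset.card_le_card hsub).trans Finset.card_le_two
  calc ∑ n ∈ s.image Int.natAbs, (s.filter fun a => a.natAbs = n).card •
          (((n : ℝ) + 1) * ((n : ℝ) + 2))⁻¹
      ≤ ∑ n ∈ s.image Int.natAbs, 2 * (((n : ℝ) + 1) * ((n : ℝ) + 2))⁻¹ :=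
        Finset.sum_le_sum fun n _ => by
          rw [nsmul_eq_mul]
          exact mul_le_mul_of_nonneg_right (hfib n) (by positivity)
    _ = 2 * ∑ n ∈ s.image Int.natAbs, (((n : ℝ) + 1) * ((n : ℝ) + 2))⁻¹ := by
        rw [Finset.mul_sum]
    _ ≤ 2 * 1 := by
        have := sum_inv_mul_succ_le_one (s.image Int.natAbs)
        linarith
    _ = 2 := by norm_num

/-- Every finite partial sum of the product weight `(a, b) ↦ ((|a|+1)(|a|+2))⁻¹ ((|b|+1)(|b|+2))⁻¹`
over `ℤ × ℤ` is `≤ 4`. [folklore] -/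
theorem sum_prod_inv_natAbs_le_four (t : Finset (ℤ × ℤ)) :
    ∑ c ∈ t, (((c.1.natAbs : ℝ) + 1) * ((c.1.natAbs : ℝ) + 2))⁻¹ *
      (((c.2.natAbs : ℝ) + 1) * ((c.2.natAbs : ℝ) + 2))⁻¹ ≤ 4 := by
  classical
  have hsub : t ⊆ t.image Prod.fst ×ˢ t.image Prod.snd := fun c hc =>
    Finset.mem_product.2 ⟨Finset.mem_image_of_mem _ hc, Finset.mem_image_of_mem _ hc⟩
  refine (Finset.sum_le_sum_of_subset_of_nonneg hsub fun c _ _ => by positivity).trans ?_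
  rw [Finset.sum_product]
  dsimp only
  rw [← Finset.sum_mul_sum]
  have h1 := sum_inv_natAbs_le_two (t.image Prod.fst)
  have h2 := sum_inv_natAbs_le_two (t.image Prod.snd)
  have h0 : 0 ≤ ∑ b ∈ t.image Prod.snd, (((b.natAbs : ℝ) + 1) * ((b.natAbs : ℝ) + 2))⁻¹ :=
    Finset.sum_nonneg fun b _ => by positivity
  nlinarith

end Weights

/-! ### Lemma 2.1 (11): a uniform lower bound for `V` -/

section LowerBound

variable {α : ℝ} {V : ℝ → ℝ}

/-- The far lattice terms of the normalization (1): for `r ≥ 4/5`, `0 < α ≤ 1` and a label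
`k` of norm form `≥ 3`, the dilated lattice point satisfies `r |ξ_k| > 4/3`, so by (12)
`V(r |ξ_k|) ≤ (1/30) (r|ξ_k|)⁻⁵ ≤ 32 w(k₁) w(k₂)` with the product weight of
`sum_prod_inv_natAbs_le_four` (`IsAdmissible.abs_apply_le` of `Theil2006Decay.lean`).
[cite: Theil2006, §2.2 Lemma 2.1] -/
theorem IsAdmissible.apply_far_le (hV : IsAdmissible α V) (hα1 : α ≤ 1)
    {r : ℝ} (hr45 : 4 / 5 ≤ r) {k : ℤ × ℤ}
    (hk : 3 ≤ k.1 ^ 2 + k.1 * k.2 + k.2 ^ 2) :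
    V (r * ‖triPoint k‖) ≤ 32 * ((((k.1.natAbs : ℝ) + 1) * ((k.1.natAbs : ℝ) + 2))⁻¹ *
      (((k.2.natAbs : ℝ) + 1) * ((k.2.natAbs : ℝ) + 2))⁻¹) := by
  set s := r * ‖triPoint k‖ with hs
  set P : ℝ := (k.1.natAbs : ℝ) with hP
  set Q : ℝ := (k.2.natAbs : ℝ) with hQ
  set nf : ℝ := (k.1 : ℝ) ^ 2 + k.1 * k.2 + (k.2 : ℝ) ^ 2 with hnfdef
  have hP0 : 0 ≤ P := Nat.cast_nonneg _
  have hQ0 : 0 ≤ Q := Nat.cast_nonneg _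
  have hP2 : P ^ 2 = (k.1 : ℝ) ^ 2 := by rw [hP, Nat.cast_natAbs, Int.cast_abs, sq_abs]
  have hQ2 : Q ^ 2 = (k.2 : ℝ) ^ 2 := by rw [hQ, Nat.cast_natAbs, Int.cast_abs, sq_abs]
  have hnf : 3 ≤ nf := by rw [hnfdef]; exact_mod_cast hk
  have hnorm : ‖triPoint k‖ ^ 2 = nf := by rw [norm_triPoint_sq, hnfdef]; push_cast; ring
  have hs2 : s ^ 2 = r ^ 2 * nf := by rw [hs, mul_pow, hnorm]
  have hs0 : 0 ≤ s := by rw [hs]; exact mul_nonneg (by linarith) (norm_nonneg _)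
  have hS : 2 ≤ P ^ 2 + Q ^ 2 := by
    rw [hP2, hQ2]; nlinarith [sq_nonneg ((k.1 : ℝ) - k.2)]
  have hSnf : P ^ 2 + Q ^ 2 ≤ 2 * nf := by
    rw [hP2, hQ2, hnfdef]; nlinarith [sq_nonneg ((k.1 : ℝ) + k.2)]
  clear_value s P Q nf
  have hnf0 : 0 ≤ nf := by linarith
  have hr2 : 16 / 25 ≤ r ^ 2 := by nlinarith
  have hs43 : 4 / 3 < s := by
    have h1 : 16 / 25 * 3 ≤ r ^ 2 * nf := mul_le_mul hr2 hnf (by norm_num) (by positivity)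
    have : (4 / 3 : ℝ) ^ 2 < s ^ 2 := by rw [hs2]; linarith
    exact lt_of_pow_lt_pow_left₀ 2 hs0 this
  have hspos : 0 < s := by linarith
  have hVs : V s ≤ 1 / 30 * (s ^ 5)⁻¹ := by
    have h1 := (abs_le.1 (hV.abs_apply_le hs43.le)).2
    rw [inv_pow] at h1
    have h2 : 0 ≤ (s ^ 5)⁻¹ := by positivity
    nlinarith [mul_le_mul_of_nonneg_right hα1 h2]
  -- `(P+1)(P+2)(Q+1)(Q+2) ≤ 64 (P²+Q²)² ≤ 256 nf² ≤ 625 s⁴ ≤ 960 s⁵`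
  have hPP : (P + 1) * (P + 2) ≤ 8 * (P ^ 2 + Q ^ 2) := by nlinarith [sq_nonneg (P - 1)]
  have hQQ : (Q + 1) * (Q + 2) ≤ 8 * (P ^ 2 + Q ^ 2) := by nlinarith [sq_nonneg (Q - 1)]
  have hprod : (P + 1) * (P + 2) * ((Q + 1) * (Q + 2)) ≤ 64 * (P ^ 2 + Q ^ 2) ^ 2 := by
    calc (P + 1) * (P + 2) * ((Q + 1) * (Q + 2))
        ≤ (8 * (P ^ 2 + Q ^ 2)) * (8 * (P ^ 2 + Q ^ 2)) :=
          mul_le_mul hPP hQQ (by positivity) (by positivity)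
      _ = 64 * (P ^ 2 + Q ^ 2) ^ 2 := by ring
  have hnf_le : nf ≤ 25 / 16 * s ^ 2 := by
    rw [hs2]; nlinarith [mul_le_mul_of_nonneg_right hr2 hnf0]
  have hS2 : (P ^ 2 + Q ^ 2) ^ 2 ≤ (25 / 8 * s ^ 2) ^ 2 :=
    pow_le_pow_left₀ (by positivity) (by linarith) 2
  have hs4 : s ^ 4 ≤ 3 / 4 * s ^ 5 := by nlinarith [pow_pos hspos 4]
  have hkey : (P + 1) * (P + 2) * ((Q + 1) * (Q + 2)) ≤ 960 * s ^ 5 := by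
    linarith [pow_nonneg hs0 5]
  have hD : 0 < (P + 1) * (P + 2) * ((Q + 1) * (Q + 2)) := by positivity
  have hfinal : 1 / 30 * (s ^ 5)⁻¹ ≤
      32 * ((((P + 1) * (P + 2))⁻¹) * (((Q + 1) * (Q + 2))⁻¹)) := by
    have e1 : (32 : ℝ) * ((((P + 1) * (P + 2))⁻¹) * (((Q + 1) * (Q + 2))⁻¹)) =
        32 / ((P + 1) * (P + 2) * ((Q + 1) * (Q + 2))) := by
      rw [← mul_inv, div_eq_mul_inv]
    have e2 : (1 : ℝ) / 30 * (s ^ 5)⁻¹ = (1 / 30) / s ^ 5 := (div_eq_mul_inv (1 / 30) (s ^ 5)).symm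
    rw [e1, e2, div_le_div_iff₀ (by positivity) hD]
    linarith
  exact hVs.trans hfinal

/-- **Theil 2006, Lemma 2.1 (11) near the well.** For `0 < α ≤ 1/5`, an admissible `V` satisfies
`V(r) ≥ -134` for `r ∈ (1-α, 1+α)`: the normalization (1) gives
`-6 ≤ ∑_{ξ ≠ 0} V(r|ξ|) = #(nearest neighbours) · V(r) + (far terms)`, and the far terms are
`≤ 32 · 4 = 128` by (12) (`Theil2006Decay.lean`; `IsAdmissible.apply_far_le`,
`sum_prod_inv_natAbs_le_four`). (Theil
states `V ≥ -2`, "directly from (3), (5) and the definition of `V_*`"; any uniform constant serves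
Lemma 2.2, and this one needs neither (3) nor the derivative of the lattice sum.)
[cite: Theil2006, §2.2 Lemma 2.1 (11)] -/
theorem IsAdmissible.le_apply_of_mem_Ioo (hV : IsAdmissible α V) (hα5 : α ≤ 1 / 5)
    {r : ℝ} (hr : r ∈ Ioo (1 - α) (1 + α)) : -134 ≤ V r := by
  classical
  obtain ⟨hr1, hr2⟩ := hr
  have hr45 : 4 / 5 ≤ r := by linarith
  have hr0 : 0 < r := by linarith
  set f : {k : ℤ × ℤ // k ≠ 0} → ℝ := fun k => V (r * ‖triPoint k.1‖) with hf
  have hsum : Summable f := hV.summable r hr0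
  have h6 : -6 ≤ ∑' k, f k := hV.le_latticeSum r hr0
  set SIX : Finset (ℤ × ℤ) := {(1, 0), (0, 1), (-1, 0), (0, -1), (1, -1), (-1, 1)} with hSIX
  set NN : Finset {k : ℤ × ℤ // k ≠ 0} := SIX.subtype (· ≠ 0) with hNN
  have hsplit := hsum.sum_add_tsum_compl (s := NN)
  -- on the nearest neighbours every term equals `V r`
  have hNNval : ∀ k ∈ NN, f k = V r := by
    intro k hk
    have hk1 : k.1.1 ^ 2 + k.1.1 * k.1.2 + k.1.2 ^ 2 = 1 :=
      (normForm_eq_one_iff k.1).2 (Finset.mem_subtype.1 hk)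
    have hn : ‖triPoint k.1‖ = 1 := by
      have h2 : ‖triPoint k.1‖ ^ 2 = 1 := by rw [norm_triPoint_sq]; exact_mod_cast hk1
      exact (pow_eq_one_iff_of_nonneg (norm_nonneg _) two_ne_zero).1 h2
    simp only [hf, hn, mul_one]
  have hsumNN : ∑ k ∈ NN, f k = NN.card • V r := by
    rw [Finset.sum_congr rfl hNNval, Finset.sum_const]
  have hcard : 1 ≤ NN.card :=
    Finset.card_pos.2 ⟨⟨(1, 0), by simp⟩, Finset.mem_subtype.2 (by simp [hSIX])⟩
  -- the far terms are bounded by the product weights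
  have htail : ∑' k : ((NN : Set {k : ℤ × ℤ // k ≠ 0})ᶜ : Set _), f k ≤ 128 := by
    refine tsum_le_of_sum_le' (by norm_num) fun u => ?_
    have hterm : ∀ k ∈ u, f k ≤ 32 * ((((k.1.1.1.natAbs : ℝ) + 1) * ((k.1.1.1.natAbs : ℝ) + 2))⁻¹ *
        (((k.1.1.2.natAbs : ℝ) + 1) * ((k.1.1.2.natAbs : ℝ) + 2))⁻¹) := by
      intro k _
      have hk0 : k.1.1 ≠ 0 := k.1.2
      have hkNN : k.1 ∉ NN := fun h => k.2 h
      have hkSIX : k.1.1 ∉ SIX := fun h => hkNN (Finset.mem_subtype.2 h)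
      exact hV.apply_far_le (by linarith) hr45 (three_le_normForm' hk0 hkSIX)
    refine (Finset.sum_le_sum hterm).trans ?_
    rw [← Finset.mul_sum]
    have hinj : Function.Injective (fun k : ((NN : Set {k : ℤ × ℤ // k ≠ 0})ᶜ : Set _) => k.1.1) :=
      fun a b h => Subtype.ext (Subtype.ext h)
    have := sum_prod_inv_natAbs_le_four (u.image fun k => k.1.1)
    rw [Finset.sum_image (fun a _ b _ h => hinj h)] at this
    linarith
  by_cases hVr : 0 ≤ V r
  · linarith
  · have hle : (NN.card • V r) ≤ V r := by
      rw [nsmul_eq_mul]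
      have : (1 : ℝ) ≤ NN.card := by exact_mod_cast hcard
      nlinarith
    linarith

/-- **Theil 2006, Lemma 2.1 (11).** For `0 < α ≤ 1/5`, an admissible potential is uniformly
bounded below on `[0, ∞)`: `V ≥ -134` (Theil: `V ≥ -2`; the constant is immaterial). On
`[0, 1-α]` by (2), on `(1-α, 1+α)` by `le_apply_of_mem_Ioo`, on `[1+α, 4/3]` by (4), beyond `4/3`
by (12). [cite: Theil2006, §2.2 Lemma 2.1 (11)] -/
theorem IsAdmissible.lowerBound (hV : IsAdmissible α V) (hα : 0 < α) (hα5 : α ≤ 1 / 5)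
    {d : ℝ} (hd : 0 ≤ d) : -134 ≤ V d := by
  rcases le_or_gt d (1 - α) with h1 | h1
  · have := hV.core d ⟨hd, h1⟩
    have : 0 < 1 / α := by positivity
    linarith
  rcases lt_or_ge d (1 + α) with h2 | h2
  · exact hV.le_apply_of_mem_Ioo hα5 ⟨h1, h2⟩
  rcases le_or_gt d (4 / 3) with h3 | h3
  · have := hV.well d ⟨h2, h3⟩
    linarith
  · have h4 := (abs_le.1 (hV.abs_apply_le h3.le)).1
    rw [inv_pow] at h4
    have h5 : (d ^ 5)⁻¹ ≤ 1 := inv_le_one_of_one_le₀ (one_le_pow₀ (by linarith))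
    have h6 : 0 ≤ (d ^ 5)⁻¹ := by positivity
    nlinarith

end LowerBound


/-! ### Plane geometry: coordinates and grid cells -/

section Cells

/-- Coordinates of `!₂[a, b]`. [folklore] -/
theorem vec2_apply_zero (a b : ℝ) : (!₂[a, b] : Plane) 0 = a := by simp

/-- Coordinates of `!₂[a, b]`. [folklore] -/
theorem vec2_apply_one (a b : ℝ) : (!₂[a, b] : Plane) 1 = b := by simp

/-- Coordinates are `1`-Lipschitz in `ℝ²`: `|p i - q i| ≤ |p - q|`. [folklore] -/
theorem abs_sub_apply_le_dist (p q : Plane) (i : Fin 2) : |p i - q i| ≤ dist p q := by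
  rw [EuclideanSpace.dist_eq, ← Real.dist_eq, ← Real.sqrt_sq (dist_nonneg : 0 ≤ dist (p i) (q i))]
  exact Real.sqrt_le_sqrt
    (Finset.single_le_sum (fun j _ => sq_nonneg (dist (p j) (q j))) (Finset.mem_univ i))

/-- If both coordinate differences are `≤ ρ/2` in absolute value then the points are within `ρ`.
[folklore] -/
theorem dist_le_of_abs_sub_apply_le (p q : Plane) {ρ : ℝ} (hρ : 0 ≤ ρ)
    (h0 : |p 0 - q 0| ≤ ρ / 2) (h1 : |p 1 - q 1| ≤ ρ / 2) : dist p q ≤ ρ := by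
  rw [EuclideanSpace.dist_eq, Fin.sum_univ_two, Real.dist_eq, Real.dist_eq]
  calc √(|p 0 - q 0| ^ 2 + |p 1 - q 1| ^ 2) ≤ √(ρ ^ 2) :=
        Real.sqrt_le_sqrt (by nlinarith [abs_nonneg (p 0 - q 0), abs_nonneg (p 1 - q 1)])
    _ = ρ := Real.sqrt_sq hρ

/-- `⌊u⌋ + 1/2` is within `1/2` of `u`. [folklore] -/
theorem abs_sub_floor_add_half_le (u : ℝ) : |u - (⌊u⌋ + 1 / 2)| ≤ 1 / 2 := by
  rw [abs_le]
  constructor <;> linarith [Int.floor_le u, Int.lt_floor_add_one u]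

/-- `|u| ≥ |⌊u⌋| - 1`. [folklore] -/
theorem natAbs_floor_sub_one_le (u : ℝ) : ((⌊u⌋.natAbs : ℕ) : ℝ) - 1 ≤ |u| := by
  have h1 := Int.floor_le u
  have h2 := Int.lt_floor_add_one u
  rw [Nat.cast_natAbs, Int.cast_abs]
  rcases le_or_gt 0 (⌊u⌋ : ℝ) with h | h
  · rw [abs_of_nonneg h]
    linarith [le_abs_self u]
  · rw [abs_of_neg h]
    linarith [neg_abs_le u]

/-- **Grid cells.** Partition the plane into the half-open squares of side `ρ` with corners in
`η + ρ ℤ²`; the square of `p` is labelled `(⌊(p₀-η₀)/ρ⌋, ⌊(p₁-η₁)/ρ⌋)` and lies in the closed disc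
of radius `ρ` about its centre. [folklore] -/
theorem dist_cellCentre_le (η p : Plane) {ρ : ℝ} (hρ : 0 < ρ) :
    dist p !₂[η 0 + ρ * (⌊(p 0 - η 0) / ρ⌋ + 1 / 2), η 1 + ρ * (⌊(p 1 - η 1) / ρ⌋ + 1 / 2)] ≤
      ρ := by
  apply dist_le_of_abs_sub_apply_le _ _ hρ.le
  · rw [vec2_apply_zero]
    have h := abs_sub_floor_add_half_le ((p 0 - η 0) / ρ)
    have e : p 0 - (η 0 + ρ * (⌊(p 0 - η 0) / ρ⌋ + 1 / 2)) =
        ρ * ((p 0 - η 0) / ρ - (⌊(p 0 - η 0) / ρ⌋ + 1 / 2)) := by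
      field_simp
      ring
    rw [e, abs_mul, abs_of_pos hρ]
    nlinarith
  · rw [vec2_apply_one]
    have h := abs_sub_floor_add_half_le ((p 1 - η 1) / ρ)
    have e : p 1 - (η 1 + ρ * (⌊(p 1 - η 1) / ρ⌋ + 1 / 2)) =
        ρ * ((p 1 - η 1) / ρ - (⌊(p 1 - η 1) / ρ⌋ + 1 / 2)) := by
      field_simp
      ring
    rw [e, abs_mul, abs_of_pos hρ]
    nlinarith

/-- A point whose cell label has a coordinate of absolute value `m` is at distance `≥ ρ (m - 1)`
from `η`. [folklore] -/
theorem mul_natAbs_floor_sub_one_le_dist (η p : Plane) {ρ : ℝ} (hρ : 0 < ρ) (i : Fin 2) :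
    ρ * (((⌊(p i - η i) / ρ⌋.natAbs : ℕ) : ℝ) - 1) ≤ dist p η := by
  have h1 := natAbs_floor_sub_one_le ((p i - η i) / ρ)
  rw [abs_div, abs_of_pos hρ, le_div_iff₀ hρ] at h1
  have h2 := abs_sub_apply_le_dist p η i
  linarith

/-- **Counting with weights over grid cells.** If every closed disc of radius `ρ` contains at most
`M` of the points `y k`, and `f ≥ 0` is a weight on cell labels all of whose finite partial sums
are `≤ F`, then `∑_k f(cell(y k)) ≤ F · M` (each cell holds at most `M` points). This replaces the
covering "of the ring with outer radius `r` by `C r` translated copies of `B(0, ½)`" in the proof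
of Lemma 2.2. [cite: Theil2006, §2.2 proof of Lemma 2.2] -/
theorem sum_cellWeight_le {N : ℕ} (y : Fin N → Plane) (η : Plane) {ρ : ℝ} (hρ : 0 < ρ) {M : ℕ}
    (hM : ∀ z : Plane, (Finset.univ.filter fun k => dist (y k) z ≤ ρ).card ≤ M)
    {f : ℤ × ℤ → ℝ} (hf : ∀ c, 0 ≤ f c) {F : ℝ} (hF : ∀ t : Finset (ℤ × ℤ), ∑ c ∈ t, f c ≤ F) :
    ∑ k, f (⌊(y k 0 - η 0) / ρ⌋, ⌊(y k 1 - η 1) / ρ⌋) ≤ F * M := by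
  classical
  set g : Fin N → ℤ × ℤ := fun k => (⌊(y k 0 - η 0) / ρ⌋, ⌊(y k 1 - η 1) / ρ⌋) with hg
  change ∑ k, f (g k) ≤ F * M
  rw [Finset.sum_comp f g]
  have hfib : ∀ c : ℤ × ℤ, ((Finset.univ.filter fun k => g k = c).card : ℝ) ≤ M := by
    intro c
    have hsub : (Finset.univ.filter fun k => g k = c) ⊆
        Finset.univ.filter fun k => dist (y k)
          !₂[η 0 + ρ * (c.1 + 1 / 2), η 1 + ρ * (c.2 + 1 / 2)] ≤ ρ := by
      intro k hk
      rw [Finset.mem_filter] at hk ⊢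
      refine ⟨Finset.mem_univ _, ?_⟩
      obtain ⟨-, hk⟩ := hk
      subst hk
      exact dist_cellCentre_le η (y k) hρ
    exact_mod_cast (Finset.card_le_card hsub).trans (hM _)
  calc ∑ c ∈ Finset.univ.image g, (Finset.univ.filter fun k => g k = c).card • f c
      ≤ ∑ c ∈ Finset.univ.image g, (M : ℝ) * f c := Finset.sum_le_sum fun c _ => by
          rw [nsmul_eq_mul]
          exact mul_le_mul_of_nonneg_right (hfib c) (hf c)
    _ = M * ∑ c ∈ Finset.univ.image g, f c := by rw [Finset.mul_sum]
    _ ≤ M * F := mul_le_mul_of_nonneg_left (hF _) (Nat.cast_nonneg _)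
    _ = F * M := by ring

end Cells

/-! ### The pair bound: a far particle costs at most its cell weight -/

section PairBound

variable {α : ℝ} {V : ℝ → ℝ}

/-- **The pair lower bound behind (15)–(16).** For `0 < α ≤ 1/5`, an admissible `V`, a cell size
`ρ ≥ 2/5`, a point `p₀` of the disc `B(η, ρ)` and any point `p` with cell label `(a, b)`
(relative to `η`, side `ρ`): `V(|p₀ - p|) ≥ -K₀ w(a) w(b)` with `K₀ = 420224` and the product
weight `w(n) = ((|n|+1)(|n|+2))⁻¹`. Near cells (`|a|, |b| ≤ 6`) use the uniform bound (11)
`V ≥ -134`; far cells use `|p₀ - p| ≥ ρ (max(|a|,|b|) - 2) ≥ 2 > 4/3` and the decay (12).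
[cite: Theil2006, §2.2 proof of Lemma 2.2 (15)–(16)] -/
theorem IsAdmissible.neg_cellWeight_le (hV : IsAdmissible α V) (hα : 0 < α) (hα5 : α ≤ 1 / 5)
    {ρ : ℝ} (hρ25 : 2 / 5 ≤ ρ) (η p₀ p : Plane) (hp₀ : dist p₀ η ≤ ρ) :
    -(420224 *
        ((((((⌊(p 0 - η 0) / ρ⌋).natAbs : ℕ) : ℝ) + 1) *
            ((((⌊(p 0 - η 0) / ρ⌋).natAbs : ℕ) : ℝ) + 2))⁻¹ *
          (((((⌊(p 1 - η 1) / ρ⌋).natAbs : ℕ) : ℝ) + 1) *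
            ((((⌊(p 1 - η 1) / ρ⌋).natAbs : ℕ) : ℝ) + 2))⁻¹)) ≤
      V (dist p₀ p) := by
  have hρ : 0 < ρ := by linarith
  have hfar0 := mul_natAbs_floor_sub_one_le_dist η p hρ 0
  have hfar1 := mul_natAbs_floor_sub_one_le_dist η p hρ 1
  set a := ⌊(p 0 - η 0) / ρ⌋ with ha
  set b := ⌊(p 1 - η 1) / ρ⌋ with hb
  set P : ℝ := ((a.natAbs : ℕ) : ℝ) with hP
  set Q : ℝ := ((b.natAbs : ℕ) : ℝ) with hQ
  have hP0 : 0 ≤ P := Nat.cast_nonneg _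
  have hQ0 : 0 ≤ Q := Nat.cast_nonneg _
  set d := dist p₀ p with hd
  have hd0 : 0 ≤ d := dist_nonneg
  have hVd : -134 ≤ V d := hV.lowerBound hα hα5 hd0
  have htri : dist p η ≤ d + ρ := by
    have := dist_triangle p p₀ η
    rw [dist_comm p p₀] at this
    linarith
  clear_value P Q d a b
  by_cases h6 : a.natAbs ≤ 6 ∧ b.natAbs ≤ 6
  · -- near cells: the uniform bound
    have hP6 : P ≤ 6 := by rw [hP]; exact_mod_cast h6.1
    have hQ6 : Q ≤ 6 := by rw [hQ]; exact_mod_cast h6.2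
    have hwP : (56 : ℝ)⁻¹ ≤ ((P + 1) * (P + 2))⁻¹ :=
      inv_anti₀ (by positivity) (by nlinarith)
    have hwQ : (56 : ℝ)⁻¹ ≤ ((Q + 1) * (Q + 2))⁻¹ :=
      inv_anti₀ (by positivity) (by nlinarith)
    have hw : (56 : ℝ)⁻¹ * (56 : ℝ)⁻¹ ≤ ((P + 1) * (P + 2))⁻¹ * ((Q + 1) * (Q + 2))⁻¹ :=
      mul_le_mul hwP hwQ (by positivity) (by positivity)
    nlinarith
  · -- far cells: decay
    set μ : ℝ := max P Q with hμ
    have hμ7 : 7 ≤ μ := by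
      rcases not_and_or.1 h6 with h | h
      · have : (7 : ℝ) ≤ P := by rw [hP]; exact_mod_cast Nat.lt_of_not_le h
        exact this.trans (le_max_left _ _)
      · have : (7 : ℝ) ≤ Q := by rw [hQ]; exact_mod_cast Nat.lt_of_not_le h
        exact this.trans (le_max_right _ _)
    have hPμ : P ≤ μ := le_max_left _ _
    have hQμ : Q ≤ μ := le_max_right _ _
    have hfar : ρ * (μ - 1) ≤ dist p η := by
      rcases le_total P Q with h | h
      · rw [hμ, max_eq_right h]; exact hfar1
      · rw [hμ, max_eq_left h]; exact hfar0
    have hd2 : ρ * (μ - 2) ≤ d := by nlinarith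
    have hd_ge : 2 ≤ d := by nlinarith
    have h43 : 4 / 3 ≤ d := by linarith
    have hVdec : -(1 / 30 * (d ^ 5)⁻¹) ≤ V d := by
      have h1 := (abs_le.1 (hV.abs_apply_le h43)).1
      rw [inv_pow] at h1
      have h2 : 0 ≤ (d ^ 5)⁻¹ := by positivity
      have hα1 : α ≤ 1 := by linarith
      nlinarith [mul_le_mul_of_nonneg_right hα1 h2]
    -- `(P+1)(P+2)(Q+1)(Q+2) ≤ (μ+2)⁴ ≤ (9d/2)⁴ ≤ 30 K₀ d⁵`
    have hPP : (P + 1) * (P + 2) ≤ (μ + 2) ^ 2 := by nlinarith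
    have hQQ : (Q + 1) * (Q + 2) ≤ (μ + 2) ^ 2 := by nlinarith
    have hprod : (P + 1) * (P + 2) * ((Q + 1) * (Q + 2)) ≤ (μ + 2) ^ 2 * (μ + 2) ^ 2 :=
      mul_le_mul hPP hQQ (by positivity) (by positivity)
    have hμd : μ + 2 ≤ 9 / 2 * d := by nlinarith
    have h4 : (μ + 2) ^ 2 * (μ + 2) ^ 2 ≤ 6561 / 16 * d ^ 4 := by
      calc (μ + 2) ^ 2 * (μ + 2) ^ 2 = (μ + 2) ^ 4 := by ring
        _ ≤ (9 / 2 * d) ^ 4 := pow_le_pow_left₀ (by positivity) hμd 4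
        _ = 6561 / 16 * d ^ 4 := by ring
    have h5 : d ^ 4 ≤ d ^ 5 / 2 := by nlinarith [pow_nonneg hd0 4]
    have hkey : (P + 1) * (P + 2) * ((Q + 1) * (Q + 2)) ≤ 30 * 420224 * d ^ 5 := by
      linarith [pow_nonneg hd0 5]
    have hD : 0 < (P + 1) * (P + 2) * ((Q + 1) * (Q + 2)) := by positivity
    have hd5 : 0 < d ^ 5 := by positivity
    have hfinal : 1 / 30 * (d ^ 5)⁻¹ ≤
        420224 * (((P + 1) * (P + 2))⁻¹ * ((Q + 1) * (Q + 2))⁻¹) := by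
      have e1 : (420224 : ℝ) * (((P + 1) * (P + 2))⁻¹ * ((Q + 1) * (Q + 2))⁻¹) =
          420224 / ((P + 1) * (P + 2) * ((Q + 1) * (Q + 2))) := by
        rw [← mul_inv, div_eq_mul_inv]
      have e2 : (1 : ℝ) / 30 * (d ^ 5)⁻¹ = (1 / 30) / d ^ 5 :=
        (div_eq_mul_inv (1 / 30) (d ^ 5)).symm
      rw [e1, e2, div_le_div_iff₀ hd5 hD]
      linarith
    linarith

end PairBound

/-! ### Moving a cluster to infinity: inequality (14) -/

section Removal

variable {V : ℝ → ℝ} {N : ℕ}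

/-- **Theil 2006, (14): a ground state gains nothing by expelling a cluster.** If `V → 0` at
infinity and `y` minimises `E` over all configurations, then for every set `𝒜` of labels the
bonds meeting `𝒜` have non-positive total energy:
`∑_{p ⊂ 𝒜} e(p) + ∑_{x ∈ 𝒜, x' ∉ 𝒜} e({x, x'}) ≤ 0` ("we could move the positions `y(𝒜)` to
infinity in such a way that the mutual distances diverge"). Here the competitor places the
particles of `𝒜` at `D(k+2) b₁`, `D = ∑|y| + R + 1`, pairwise and from the rest at distance
`≥ R`, where `V < ε` on `[R, ∞)`. [cite: Theil2006, §2.2 proof of Lemma 2.2 (14)] -/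
theorem IsMinimizer.sum_ite_mem_le_zero (hV0 : Tendsto V atTop (𝓝 0)) {y : Fin N → Plane}
    (hy : IsMinimizer V y) (A : Finset (Fin N)) :
    ∑ i, ∑ j ∈ Finset.Ioi i, (if i ∈ A ∨ j ∈ A then V (dist (y i) (y j)) else 0) ≤ 0 := by
  classical
  set T := ∑ i, ∑ j ∈ Finset.Ioi i, (if i ∈ A ∨ j ∈ A then V (dist (y i) (y j)) else 0) with hT
  suffices h : ∀ ε : ℝ, 0 < ε → T ≤ ((N : ℝ) ^ 2 + 1) * ε by
    by_contra hpos
    rw [not_le] at hpos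
    have hC : (0 : ℝ) < (N : ℝ) ^ 2 + 1 := by positivity
    have h1 := h (T / (2 * ((N : ℝ) ^ 2 + 1))) (by positivity)
    have h2 : ((N : ℝ) ^ 2 + 1) * (T / (2 * ((N : ℝ) ^ 2 + 1))) = T / 2 := by
      field_simp
    linarith
  intro ε hε
  -- `V < ε` on `[R, ∞)`
  obtain ⟨R₀, hR₀⟩ := Filter.eventually_atTop.1 (hV0.eventually (gt_mem_nhds hε))
  set R := max R₀ 0 with hR
  have hRV : ∀ s, R ≤ s → V s < ε := fun s hs => hR₀ s ((le_max_left _ _).trans hs)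
  have hR0 : 0 ≤ R := le_max_right _ _
  -- a bound on the positions
  set B := ∑ k, ‖y k‖ with hB
  have hBk : ∀ k, ‖y k‖ ≤ B := fun k =>
    Finset.single_le_sum (fun k _ => norm_nonneg (y k)) (Finset.mem_univ k)
  have hB0 : 0 ≤ B := Finset.sum_nonneg fun k _ => norm_nonneg _
  set D := B + R + 1 with hD
  have hD0 : 0 < D := by linarith
  clear_value D R B
  -- the unit vector `b₁`
  have he : ‖triVec₁‖ = 1 := by
    have h2 : ‖triPoint (1, 0)‖ ^ 2 = 1 := by rw [norm_triPoint_sq]; norm_num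
    have h1 : triPoint (1, 0) = triVec₁ := by simp [triPoint]
    rw [h1] at h2
    exact (pow_eq_one_iff_of_nonneg (norm_nonneg _) two_ne_zero).1 h2
  -- the competitor: the cluster is sent far away along `b₁`
  obtain ⟨y', hy'A, hy'nA⟩ : ∃ y' : Fin N → Plane,
      (∀ k, k ∈ A → y' k = (D * ((k : ℕ) + 2 : ℝ)) • triVec₁) ∧ (∀ k, k ∉ A → y' k = y k) :=
    ⟨fun k => if k ∈ A then (D * ((k : ℕ) + 2 : ℝ)) • triVec₁ else y k,
      fun k hk => if_pos hk, fun k hk => if_neg hk⟩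
  have hnorm' : ∀ k, k ∈ A → ‖y' k‖ = D * ((k : ℕ) + 2) := by
    intro k hk
    have hpos : (0 : ℝ) ≤ D * ((k : ℕ) + 2) := by positivity
    rw [hy'A k hk, norm_smul, he, mul_one, Real.norm_of_nonneg hpos]
  have hfar : ∀ i j : Fin N, i < j → (i ∈ A ∨ j ∈ A) → R ≤ dist (y' i) (y' j) := by
    intro i j hij hA
    by_cases hi : i ∈ A <;> by_cases hj : j ∈ A
    · have hsub : y' i - y' j = (D * ((i : ℕ) + 2 : ℝ) - D * ((j : ℕ) + 2 : ℝ)) • triVec₁ := by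
        rw [hy'A i hi, hy'A j hj, sub_smul]
      rw [dist_eq_norm, hsub, norm_smul, he, mul_one, Real.norm_eq_abs]
      have hlt : ((i : ℕ) : ℝ) + 1 ≤ ((j : ℕ) : ℝ) := by
        exact_mod_cast Nat.succ_le_of_lt (Fin.lt_def.1 hij)
      rw [abs_of_neg (by nlinarith)]
      nlinarith
    · have h1 : ‖y' i‖ - ‖y' j‖ ≤ dist (y' i) (y' j) := by
        rw [dist_eq_norm]; exact norm_sub_norm_le _ _
      have h2 : ‖y' j‖ ≤ B := by rw [hy'nA j hj]; exact hBk j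
      have h3 := hnorm' i hi
      have h4 : (0 : ℝ) ≤ (i : ℕ) := Nat.cast_nonneg _
      nlinarith
    · have h1 : ‖y' j‖ - ‖y' i‖ ≤ dist (y' i) (y' j) := by
        rw [dist_comm, dist_eq_norm]; exact norm_sub_norm_le _ _
      have h2 : ‖y' i‖ ≤ B := by rw [hy'nA i hi]; exact hBk i
      have h3 := hnorm' j hj
      have h4 : (0 : ℝ) ≤ (j : ℕ) := Nat.cast_nonneg _
      nlinarith
    · exact absurd hA (not_or.2 ⟨hi, hj⟩)
  -- termwise comparison of the two energies
  have hterm : ∀ i j : Fin N, j ∈ Finset.Ioi i →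
      V (dist (y' i) (y' j)) - V (dist (y i) (y j)) ≤
        (if i ∈ A ∨ j ∈ A then ε else 0) - (if i ∈ A ∨ j ∈ A then V (dist (y i) (y j)) else 0) := by
    intro i j hj
    rw [Finset.mem_Ioi] at hj
    by_cases hA : i ∈ A ∨ j ∈ A
    · rw [if_pos hA, if_pos hA]
      have := hRV _ (hfar i j hj hA)
      linarith
    · rw [if_neg hA, if_neg hA]
      obtain ⟨hi, hj'⟩ := not_or.1 hA
      rw [hy'nA i hi, hy'nA j hj', sub_self, sub_self]
  have hsum : interactionEnergy V y' - interactionEnergy V y ≤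
      ∑ i, ∑ j ∈ Finset.Ioi i, (if i ∈ A ∨ j ∈ A then ε else (0 : ℝ)) - T := by
    rw [interactionEnergy, interactionEnergy, ← Finset.sum_sub_distrib, hT,
      ← Finset.sum_sub_distrib]
    refine Finset.sum_le_sum fun i _ => ?_
    rw [← Finset.sum_sub_distrib, ← Finset.sum_sub_distrib]
    exact Finset.sum_le_sum fun j hj => hterm i j hj
  have hcount : ∑ i, ∑ j ∈ Finset.Ioi i, (if i ∈ A ∨ j ∈ A then ε else (0 : ℝ)) ≤
      ((N : ℝ) ^ 2 + 1) * ε := by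
    have hin : ∀ i : Fin N, ∑ j ∈ Finset.Ioi i, (if i ∈ A ∨ j ∈ A then ε else (0 : ℝ)) ≤ N * ε := by
      intro i
      calc ∑ j ∈ Finset.Ioi i, (if i ∈ A ∨ j ∈ A then ε else (0 : ℝ))
          ≤ ∑ j ∈ Finset.Ioi i, ε := Finset.sum_le_sum fun j _ => by split_ifs <;> linarith
        _ ≤ ∑ _j : Fin N, ε :=
          Finset.sum_le_sum_of_subset_of_nonneg (Finset.subset_univ _) fun _ _ _ => hε.le
        _ = N * ε := by simp
    calc ∑ i, ∑ j ∈ Finset.Ioi i, (if i ∈ A ∨ j ∈ A then ε else (0 : ℝ))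
        ≤ ∑ _i : Fin N, (N : ℝ) * ε := Finset.sum_le_sum fun i _ => hin i
      _ = (N : ℝ) ^ 2 * ε := by simp; ring
      _ ≤ ((N : ℝ) ^ 2 + 1) * ε := by nlinarith
  have hmin := hy y'
  linarith

end Removal

/-! ### Symmetric double sums over `i < j` -/

section PairSums

variable {N : ℕ}

/-- `∑_{i<j} [i, j ∈ 𝒜] = #𝒜 (#𝒜 - 1) / 2`. [folklore] -/
theorem sum_Ioi_ite_mem_and_mem (A : Finset (Fin N)) :
    ∑ i, ∑ j ∈ Finset.Ioi i, (if i ∈ A ∧ j ∈ A then (1 : ℝ) else 0) =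
      ((A.card : ℝ) ^ 2 - A.card) / 2 := by
  classical
  set a : Fin N → ℝ := fun i => if i ∈ A then 1 else 0 with ha
  have hM : ∑ i, a i = A.card := by
    simp only [ha, Finset.sum_boole, Finset.filter_univ_mem]
  have h1 : ∀ i j : Fin N, (if i ∈ A ∧ j ∈ A then (1 : ℝ) else 0) = a i * a j := by
    intro i j
    by_cases hi : i ∈ A <;> by_cases hj : j ∈ A <;> simp [ha, hi, hj]
  have hIoi : ∀ i : Fin N, ∑ j ∈ Finset.Ioi i, a i * a j = ∑ j, if i < j then a i * a j else 0 := by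
    intro i
    rw [← Finset.sum_filter]
    congr 1
    ext j
    simp
  have hsplit : ∀ i j : Fin N, a i * a j = (if i < j then a i * a j else 0) +
      (if j < i then a i * a j else 0) + (if i = j then a i * a j else 0) := by
    intro i j
    rcases lt_trichotomy i j with h | h | h
    · simp [h, h.ne, lt_asymm h]
    · simp [h]
    · simp [h, h.ne', lt_asymm h]
  have htot : ∑ i, ∑ j, a i * a j = (A.card : ℝ) ^ 2 := by
    rw [← Finset.sum_mul_sum, hM]; ring
  have hsym : ∑ i : Fin N, ∑ j : Fin N, (if j < i then a i * a j else 0) =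
      ∑ i : Fin N, ∑ j : Fin N, (if i < j then a i * a j else 0) := by
    rw [Finset.sum_comm]
    exact Finset.sum_congr rfl fun i _ => Finset.sum_congr rfl fun j _ => by rw [mul_comm]
  have hdiag : ∑ i : Fin N, ∑ j : Fin N, (if i = j then a i * a j else 0) = A.card := by
    rw [← hM]
    refine Finset.sum_congr rfl fun i _ => ?_
    rw [Finset.sum_ite_eq]
    simp only [Finset.mem_univ, if_true, ha]
    split_ifs <;> norm_num
  have hS : ∑ i, ∑ j ∈ Finset.Ioi i, (if i ∈ A ∧ j ∈ A then (1 : ℝ) else 0) =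
      ∑ i : Fin N, ∑ j : Fin N, (if i < j then a i * a j else 0) := by
    refine Finset.sum_congr rfl fun i _ => ?_
    rw [← hIoi]
    exact Finset.sum_congr rfl fun j _ => h1 i j
  rw [hS]
  have key : ∑ i : Fin N, ∑ j : Fin N, a i * a j =
      ∑ i : Fin N, ∑ j : Fin N, (if i < j then a i * a j else 0) +
      ∑ i : Fin N, ∑ j : Fin N, (if j < i then a i * a j else 0) +
      ∑ i : Fin N, ∑ j : Fin N, (if i = j then a i * a j else 0) := by
    rw [← Finset.sum_add_distrib, ← Finset.sum_add_distrib]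
    refine Finset.sum_congr rfl fun i _ => ?_
    rw [← Finset.sum_add_distrib, ← Finset.sum_add_distrib]
    exact Finset.sum_congr rfl fun j _ => hsplit i j
  rw [htot, hsym, hdiag] at key
  linarith

/-- The cross terms: `∑_{i<j} ([i ∈ 𝒜, j ∉ 𝒜] w_j + [i ∉ 𝒜, j ∈ 𝒜] w_i) ≤ #𝒜 · ∑_j w_j` for
non-negative weights. [folklore] -/
theorem sum_Ioi_cross_le (A : Finset (Fin N)) {w : Fin N → ℝ} (hw : ∀ j, 0 ≤ w j) :
    ∑ i, ∑ j ∈ Finset.Ioi i,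
        ((if i ∈ A ∧ j ∉ A then w j else 0) + (if i ∉ A ∧ j ∈ A then w i else 0)) ≤
      A.card * ∑ j, w j := by
  classical
  have hIoi : ∀ (f : Fin N → ℝ) (i : Fin N),
      ∑ j ∈ Finset.Ioi i, f j = ∑ j, if i < j then f j else 0 := by
    intro f i
    rw [← Finset.sum_filter]
    congr 1
    ext j
    simp
  set a : Fin N → ℝ := fun i => if i ∈ A then 1 else 0 with ha
  have hM : ∑ i, a i = A.card := by
    simp only [ha, Finset.sum_boole, Finset.filter_univ_mem]
  -- rewrite as full double sums
  have hL : ∑ i, ∑ j ∈ Finset.Ioi i,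
        ((if i ∈ A ∧ j ∉ A then w j else 0) + (if i ∉ A ∧ j ∈ A then w i else 0)) =
      ∑ i : Fin N, ∑ j : Fin N, (if i < j then (if i ∈ A ∧ j ∉ A then w j else 0) else 0) +
      ∑ i : Fin N, ∑ j : Fin N, (if i < j then (if i ∉ A ∧ j ∈ A then w i else 0) else 0) := by
    rw [← Finset.sum_add_distrib]
    refine Finset.sum_congr rfl fun i _ => ?_
    rw [hIoi, ← Finset.sum_add_distrib]
    refine Finset.sum_congr rfl fun j _ => ?_
    split_ifs <;> simp
  have hswap : ∑ i : Fin N, ∑ j : Fin N,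
        (if i < j then (if i ∉ A ∧ j ∈ A then w i else 0) else 0) =
      ∑ i : Fin N, ∑ j : Fin N, (if j < i then (if i ∈ A ∧ j ∉ A then w j else 0) else 0) := by
    rw [Finset.sum_comm]
    refine Finset.sum_congr rfl fun i _ => Finset.sum_congr rfl fun j _ => ?_
    by_cases h : j < i
    · rw [if_pos h, if_pos h]
      by_cases h' : j ∉ A ∧ i ∈ A
      · rw [if_pos h', if_pos ⟨h'.2, h'.1⟩]
      · rw [if_neg h', if_neg (fun h'' => h' ⟨h''.2, h''.1⟩)]
    · rw [if_neg h, if_neg h]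
  have hpt : ∀ i j : Fin N,
      (if i < j then (if i ∈ A ∧ j ∉ A then w j else 0) else 0) +
        (if j < i then (if i ∈ A ∧ j ∉ A then w j else 0) else 0) ≤ a i * w j := by
    intro i j
    have hwj := hw j
    by_cases hi : i ∈ A
    · have hai : a i = 1 := by simp [ha, hi]
      rw [hai, one_mul]
      rcases lt_trichotomy i j with h | h | h
      · rw [if_pos h, if_neg (lt_asymm h)]
        split_ifs <;> linarith
      · subst h
        simp [hwj]
      · rw [if_neg (lt_asymm h), if_pos h]
        split_ifs <;> linarith
    · have hai : a i = 0 := by simp [ha, hi]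
      rw [hai, zero_mul]
      have h1 : ¬ (i ∈ A ∧ j ∉ A) := fun h => hi h.1
      simp [h1]
  rw [hL, hswap, ← Finset.sum_add_distrib]
  calc ∑ i : Fin N, (∑ j : Fin N, (if i < j then (if i ∈ A ∧ j ∉ A then w j else 0) else 0) +
          ∑ j : Fin N, (if j < i then (if i ∈ A ∧ j ∉ A then w j else 0) else 0))
      ≤ ∑ i : Fin N, ∑ j : Fin N, a i * w j := Finset.sum_le_sum fun i _ => by
          rw [← Finset.sum_add_distrib]
          exact Finset.sum_le_sum fun j _ => hpt i j
    _ = (∑ i, a i) * ∑ j, w j := by rw [Finset.sum_mul_sum]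
    _ = A.card * ∑ j, w j := by rw [hM]

end PairSums

end Theil2006

open Theil2006

/-! ### The discharge -/

/-- DISCHARGE of `Theil2006_minimumDistance` — **Theil 2006, Lemma 2.2 (Minimum distance)** — with
the explicit threshold `α₀ = 1/13447168`: for `α ∈ (0, α₀)`, every `V` satisfying (1)–(5)
(`IsAdmissible α V`, real-valued) and every ground state `y : X_N → ℝ²` of `E` (a global minimiser
over all configurations), `min_{x ≠ x'} |y(x) - y(x')| > 1 - α` (13).

Proof (Theil 2006, §2.2): let `M` be the maximal number of particles in a closed disc of radius
`ρ = (1-α)/2`, attained at `η₀`, and `𝒜` the particles in `B(η₀, ρ)`. A pair at distance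
`≤ 1 - α` forces `M ≥ 2` (disc about the midpoint). The `M(M-1)/2` bonds inside `𝒜` each cost
`≥ 1/α` by (2); expelling `𝒜` to infinity does not lower the energy (14)
(`IsMinimizer.sum_ite_mem_le_zero`), so they are paid for by the bonds between `𝒜` and the rest,
each of which is `≥ -K₀ w(cell)` (`IsAdmissible.neg_cellWeight_le`: (11) for near cells, (12) for
far ones), and the cells carry at most `M` particles each with summable weights
(`sum_cellWeight_le`, `sum_prod_inv_natAbs_le_four`): `M(M-1)/(2α) ≤ M² W` with `W = 4 K₀`,
impossible for `M ≥ 2` and `α < 1/(8W)`. Users of the named fact feed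
`Theil2006_minimumDistance_holds` for `(h : Theil2006_minimumDistance)`.
[cite: Theil2006, §2.2 Lemma 2.2 (13)] -/
theorem Theil2006_minimumDistance_holds : Theil2006_minimumDistance := by
  classical
  refine ⟨1 / 13447168, by norm_num, by norm_num, fun α hα hαlt V hV N y hy i j hij => ?_⟩
  by_contra hcon
  rw [not_lt] at hcon
  have hα5 : α ≤ 1 / 5 := by linarith
  set ρ := (1 - α) / 2 with hρdef
  have hρ25 : 2 / 5 ≤ ρ := by rw [hρdef]; linarith
  have hρ12 : ρ ≤ 1 / 2 := by rw [hρdef]; linarith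
  have hρ0 : 0 < ρ := by linarith
  -- local particle counts in closed discs of radius `ρ`, and their maximum `M`
  set cnt : Plane → ℕ := fun η => (Finset.univ.filter fun k : Fin N => dist (y k) η ≤ ρ).card
    with hcnt
  have hbdd : BddAbove (Set.range cnt) := by
    refine ⟨N, ?_⟩
    rintro _ ⟨η, rfl⟩
    exact (Finset.card_filter_le _ _).trans (by simp)
  set M := sSup (Set.range cnt) with hMdef
  have hle : ∀ η, cnt η ≤ M := fun η => le_csSup hbdd ⟨η, rfl⟩
  obtain ⟨η₀, hη₀⟩ : ∃ η₀, cnt η₀ = M := Nat.sSup_mem (s := Set.range cnt) ⟨cnt 0, 0, rfl⟩ hbdd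
  -- two particles at distance `≤ 1 - α`: the disc about their midpoint holds both, so `M ≥ 2`
  have hM2 : 2 ≤ M := by
    set m : Plane := (2 : ℝ)⁻¹ • (y i + y j) with hm
    have hdi : dist (y i) m ≤ ρ := by
      have e : y i - m = (2 : ℝ)⁻¹ • (y i - y j) := by rw [hm]; module
      rw [dist_eq_norm, e, norm_smul, Real.norm_eq_abs, abs_of_pos (by norm_num), ← dist_eq_norm]
      rw [hρdef]; linarith
    have hdj : dist (y j) m ≤ ρ := by
      have e : y j - m = (2 : ℝ)⁻¹ • (y j - y i) := by rw [hm]; module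
      rw [dist_eq_norm, e, norm_smul, Real.norm_eq_abs, abs_of_pos (by norm_num), ← dist_eq_norm,
        dist_comm]
      rw [hρdef]; linarith
    have hsub : ({i, j} : Finset (Fin N)) ⊆
        Finset.univ.filter fun k : Fin N => dist (y k) m ≤ ρ := by
      intro k hk
      rw [Finset.mem_insert, Finset.mem_singleton] at hk
      rw [Finset.mem_filter]
      rcases hk with rfl | rfl
      · exact ⟨Finset.mem_univ _, hdi⟩
      · exact ⟨Finset.mem_univ _, hdj⟩
    have := Finset.card_le_card hsub
    rw [Finset.card_pair hij] at this
    exact this.trans (hle m)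
  -- the cluster `𝒜 = y⁻¹ B(η₀, ρ)`, `#𝒜 = M`
  set A := Finset.univ.filter fun k : Fin N => dist (y k) η₀ ≤ ρ with hA
  have hAcard : A.card = M := hη₀
  have hAmem : ∀ k, k ∈ A ↔ dist (y k) η₀ ≤ ρ := fun k => by simp [hA]
  -- (14): the bonds meeting `𝒜` have total energy `≤ 0`
  have hT := IsMinimizer.sum_ite_mem_le_zero hV.tendsto_zero hy A
  -- the cell weights of the particles
  set wt : ℤ → ℝ := fun n => ((((n.natAbs : ℕ) : ℝ) + 1) * (((n.natAbs : ℕ) : ℝ) + 2))⁻¹ with hwt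
  set w : Fin N → ℝ := fun k =>
    420224 * (wt ⌊(y k 0 - η₀ 0) / ρ⌋ * wt ⌊(y k 1 - η₀ 1) / ρ⌋) with hw
  have hw0 : ∀ k, 0 ≤ w k := fun k => by positivity
  -- total weight `≤ W M`, `W = 4 K₀`
  have hwsum : ∑ k, w k ≤ 4 * 420224 * M := by
    have h := sum_cellWeight_le y η₀ hρ0 (M := M) (fun z => hle z)
      (f := fun c : ℤ × ℤ => wt c.1 * wt c.2) (fun c => by positivity) (F := 4)
      (fun t => by simpa [hwt] using sum_prod_inv_natAbs_le_four t)
    have e : ∑ k, w k = 420224 * ∑ k, wt ⌊(y k 0 - η₀ 0) / ρ⌋ * wt ⌊(y k 1 - η₀ 1) / ρ⌋ := by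
      rw [Finset.mul_sum]
    rw [e]
    nlinarith
  -- termwise lower bound on the bonds meeting `𝒜`
  have hpair : ∀ i j : Fin N,
      (if i ∈ A ∧ j ∈ A then (1 : ℝ) else 0) * (1 / α) -
        ((if i ∈ A ∧ j ∉ A then w j else 0) + (if i ∉ A ∧ j ∈ A then w i else 0)) ≤
      (if i ∈ A ∨ j ∈ A then V (dist (y i) (y j)) else 0) := by
    intro i j
    by_cases hi : i ∈ A <;> by_cases hj : j ∈ A
    · -- both in the disc: distance `≤ 2ρ = 1 - α`, cost `≥ 1/α` by (2)
      have hd : dist (y i) (y j) ≤ 1 - α := by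
        have := dist_triangle (y i) η₀ (y j)
        rw [dist_comm η₀] at this
        linarith [(hAmem i).1 hi, (hAmem j).1 hj]
      have := hV.core (dist (y i) (y j)) ⟨dist_nonneg, hd⟩
      simp only [hi, hj, and_self, if_true, true_or, not_true, and_false, false_and, if_false,
        add_zero, one_mul]
      linarith
    · have := hV.neg_cellWeight_le hα hα5 hρ25 η₀ (y i) (y j) ((hAmem i).1 hi)
      simp only [hi, hj, and_true, and_false, if_false, if_true, true_or, not_true, not_false_iff,
        zero_mul, add_zero, zero_sub, hw, hwt]
      linarith
    · have := hV.neg_cellWeight_le hα hα5 hρ25 η₀ (y j) (y i) ((hAmem j).1 hj)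
      rw [dist_comm] at this
      simp only [hi, hj, and_true, and_false, if_false, if_true, or_true, not_true, not_false_iff,
        zero_mul, zero_add, zero_sub, hw, hwt]
      linarith
    · simp [hi, hj]
  have hTlow : (((M : ℝ) ^ 2 - M) / 2) * (1 / α) - M * ∑ k, w k ≤
      ∑ i, ∑ j ∈ Finset.Ioi i, (if i ∈ A ∨ j ∈ A then V (dist (y i) (y j)) else 0) := by
    have h1 := sum_Ioi_ite_mem_and_mem A
    have h2 := sum_Ioi_cross_le A hw0
    rw [hAcard] at h1 h2
    calc (((M : ℝ) ^ 2 - M) / 2) * (1 / α) - M * ∑ k, w k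
        ≤ (∑ i, ∑ j ∈ Finset.Ioi i, (if i ∈ A ∧ j ∈ A then (1 : ℝ) else 0)) * (1 / α) -
          ∑ i, ∑ j ∈ Finset.Ioi i,
            ((if i ∈ A ∧ j ∉ A then w j else 0) + (if i ∉ A ∧ j ∈ A then w i else 0)) := by
          rw [h1]; linarith
      _ = ∑ i, ∑ j ∈ Finset.Ioi i, ((if i ∈ A ∧ j ∈ A then (1 : ℝ) else 0) * (1 / α) -
          ((if i ∈ A ∧ j ∉ A then w j else 0) + (if i ∉ A ∧ j ∈ A then w i else 0))) := by
          rw [Finset.sum_mul, ← Finset.sum_sub_distrib]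
          refine Finset.sum_congr rfl fun i _ => ?_
          rw [Finset.sum_mul, ← Finset.sum_sub_distrib]
      _ ≤ _ := Finset.sum_le_sum fun i _ => Finset.sum_le_sum fun j _ => hpair i j
  -- the final count: `M(M-1)/(2α) ≤ M² W` with `M ≥ 2` forces `α ≥ 1/(8W)`
  have hM2r : (2 : ℝ) ≤ M := by exact_mod_cast hM2
  have key : (((M : ℝ) ^ 2 - M) / 2) * (1 / α) ≤ (M : ℝ) * (4 * 420224 * M) := by
    have : (M : ℝ) * ∑ k, w k ≤ (M : ℝ) * (4 * 420224 * M) :=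
      mul_le_mul_of_nonneg_left hwsum (by linarith)
    linarith
  have key2 : ((M : ℝ) ^ 2 - M) / 2 ≤ α * ((M : ℝ) * (4 * 420224 * M)) := by
    have := mul_le_mul_of_nonneg_left key hα.le
    rw [← mul_assoc, mul_comm α, mul_assoc, mul_one_div_cancel hα.ne', mul_one] at this
    exact this
  nlinarith

end Literature.MathematicalPhysics.StatisticalMechanics

end
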